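import Mathlib

/-!
# Crux `DrudeDissolution` (stmt-AtomisticToContinuum-12593): a window density does NOT give `C ∈ L¹`

Negative-lane lemma of the standing crux disprover (cycle 1), companion of
`SpectralPairNecessities.lean` (extracted from the crux workfile
`Summits/AtomisticToContinuum/FouriersLaw/Cruxes/DrudeDissolution/Disproof.lean` §5). The crux's
conclusion (finite current spectral measure `σ` with `C = ∫cos dσ` and a continuous positive
density on a window around `0`) is STRICTLY WEAKER than the `HasGreenKubo` clause of
`FourierGreenKubo` (stmt-0703, `C ∈ L¹(0,∞)`), already in pure analysis:
`σ = e^{-ω²/2}dω + δ_2` is finite, `C(t) = √(2π)e^{-t²/2} + cos 2t` has the perfect window `(−1,1)`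
with density `e^{-ω²/2}`, `g 0 = 1`, and `C ∉ L¹(0,∞)` — an atom of `σ` AWAY from `0` is an
undamped oscillation of `C`, harmless for the Abel limit `πg(0)` that the route's assembly uses.

* `integral_cos_mul_gaussian` : `∫ cos(ωt) e^{-ω²/2} dω = √(2π) e^{-t²/2}` (real part of Mathlib's
  `fourierIntegral_gaussian`);
* `not_integrableOn_cos_two_mul`, `exists_window_not_integrable`.

Sorry-free; Mathlib only; axioms `propext`, `Classical.choice`, `Quot.sound`.
-/

noncomputable section

namespace Summit.AtomisticToContinuum.FouriersLaw.Theorems.DrudeDissolution.Negative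

open MeasureTheory Filter Set Topology

section WindowNotL1
open Complex
open scoped Real

/-- Gaussian cosine transform: `∫ cos(ω t) e^{-ω²/2} dω = √(2π) e^{-t²/2}`. -/
theorem integral_cos_mul_gaussian (t : ℝ) :
    ∫ ω : ℝ, Real.cos (ω * t) * Real.exp (-(ω ^ 2 / 2)) =
      Real.sqrt (2 * π) * Real.exp (-(t ^ 2 / 2)) := by
  have hb : (0 : ℝ) < ((1 / 2 : ℂ)).re := by norm_num
  have key := fourierIntegral_gaussian hb (t : ℂ)
  -- integrability of the complex integrand
  have hint : Integrable (fun x : ℝ => cexp (I * (t : ℂ) * x) * cexp (-(1 / 2 : ℂ) * (x : ℂ) ^ 2)) := by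
    have h := integrable_cexp_quadratic hb (I * (t : ℂ)) 0
    refine h.congr (Eventually.of_forall fun x => ?_)
    simp only
    rw [← Complex.exp_add]
    congr 1
    ring
  -- real parts of the integrand
  have hre : ∀ x : ℝ, (cexp (I * (t : ℂ) * x) * cexp (-(1 / 2 : ℂ) * (x : ℂ) ^ 2)).re =
      Real.cos (x * t) * Real.exp (-(x ^ 2 / 2)) := by
    intro x
    have h1 : I * (t : ℂ) * x = ((t * x : ℝ) : ℂ) * I := by push_cast; ring
    have h2 : -(1 / 2 : ℂ) * (x : ℂ) ^ 2 = ((-(x ^ 2 / 2) : ℝ) : ℂ) := by push_cast; ring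
    rw [h1, h2, Complex.exp_mul_I, ← Complex.ofReal_exp, ← Complex.ofReal_cos, ← Complex.ofReal_sin]
    simp only [Complex.mul_re, Complex.add_re, Complex.ofReal_re, Complex.mul_im, Complex.add_im,
      Complex.ofReal_im, Complex.I_re, Complex.I_im]
    rw [mul_comm x t]
    ring
  have hlhs : (∫ x : ℝ, cexp (I * (t : ℂ) * x) * cexp (-(1 / 2 : ℂ) * (x : ℂ) ^ 2)).re =
      ∫ ω : ℝ, Real.cos (ω * t) * Real.exp (-(ω ^ 2 / 2)) := by
    have h := integral_re hint
    simp only [RCLike.re_to_complex] at h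
    rw [← h]
    exact integral_congr_ae (Eventually.of_forall hre)
  have hrhs : ((π / (1 / 2 : ℂ)) ^ (1 / 2 : ℂ) * cexp (-(t : ℂ) ^ 2 / (4 * (1 / 2 : ℂ)))).re =
      Real.sqrt (2 * π) * Real.exp (-(t ^ 2 / 2)) := by
    have h2 : (π / (1 / 2 : ℂ)) ^ (1 / 2 : ℂ) = ((Real.sqrt (2 * π) : ℝ) : ℂ) := by
      rw [Real.sqrt_eq_rpow, ofReal_cpow (by positivity) (1 / 2)]
      congr 1
      · push_cast; ring
      · push_cast; ring
    have h3 : cexp (-(t : ℂ) ^ 2 / (4 * (1 / 2 : ℂ))) = ((Real.exp (-(t ^ 2 / 2)) : ℝ) : ℂ) := by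
      rw [Complex.ofReal_exp]
      congr 1
      push_cast; ring
    rw [h2, h3, ← Complex.ofReal_mul, Complex.ofReal_re]
  have := congrArg Complex.re key
  rw [hlhs, hrhs] at this
  exact this

/-- The Gaussian `ω ↦ e^{-ω²/2}` is integrable. -/
theorem integrable_gaussian : Integrable (fun ω : ℝ => Real.exp (-(ω ^ 2 / 2))) := by
  refine (integrable_exp_neg_mul_sq (by norm_num : (0 : ℝ) < 1 / 2)).congr ?_
  exact Eventually.of_forall fun x => by simp only; congr 1; ring

/-- `t ↦ cos (2t)` is not integrable on `(0, ∞)`. -/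
theorem not_integrableOn_cos_two_mul : ¬ IntegrableOn (fun t : ℝ => Real.cos (2 * t)) (Ioi 0) := by
  intro hB
  have hBabs : IntegrableOn (fun t : ℝ => |Real.cos (2 * t)|) (Ioi 0) := hB.abs
  set M : ℝ := ∫ t in Ioi (0 : ℝ), |Real.cos (2 * t)| with hM
  have hM0 : 0 ≤ M := setIntegral_nonneg measurableSet_Ioi fun t _ => abs_nonneg _
  -- lower bound of the truncated integrals
  have hlow : ∀ R : ℝ, 0 ≤ R → R / 2 - 1 / 8 ≤ M := by
    intro R hR
    have hcont : Continuous fun t : ℝ => Real.cos (2 * t) :=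
      Real.continuous_cos.comp (continuous_const.mul continuous_id)
    -- (1) ∫₀^R cos²(2t) = (cos(2R) sin(2R) + 2R)/4
    have h1 : ∫ t in (0 : ℝ)..R, Real.cos (2 * t) ^ 2 =
        2⁻¹ * ((Real.cos (2 * R) * Real.sin (2 * R) - Real.cos 0 * Real.sin 0 + 2 * R - 0) / 2) := by
      have := intervalIntegral.integral_comp_mul_left (a := 0) (b := R) (fun u => Real.cos u ^ 2)
        (two_ne_zero)
      rw [this, integral_cos_sq, smul_eq_mul, mul_zero]
    have h2 : R / 2 - 1 / 8 ≤ ∫ t in (0 : ℝ)..R, Real.cos (2 * t) ^ 2 := by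
      rw [h1, Real.cos_zero, Real.sin_zero]
      nlinarith [Real.cos_sq_add_sin_sq (2 * R), sq_nonneg (Real.cos (2 * R) + Real.sin (2 * R))]
    -- (2) cos² ≤ |cos|
    have h3 : ∫ t in (0 : ℝ)..R, Real.cos (2 * t) ^ 2 ≤ ∫ t in (0 : ℝ)..R, |Real.cos (2 * t)| := by
      refine intervalIntegral.integral_mono_on hR ((hcont.pow 2).intervalIntegrable 0 R)
        (hcont.abs.intervalIntegrable 0 R) fun t _ => ?_
      rw [← sq_abs]
      exact pow_le_of_le_one (abs_nonneg _) (Real.abs_cos_le_one _) two_ne_zero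
    -- (3) truncated ≤ full
    have h4 : ∫ t in (0 : ℝ)..R, |Real.cos (2 * t)| ≤ M := by
      rw [intervalIntegral.integral_of_le hR, hM]
      refine setIntegral_mono_set hBabs (Eventually.of_forall fun t => abs_nonneg _)
        (Eventually.of_forall Ioc_subset_Ioi_self)
    linarith
  have := hlow (2 * M + 1) (by linarith)
  linarith

/-- **A WINDOW DENSITY DOES NOT GIVE `C ∈ L¹`** (the crux's conclusion is strictly weaker than the
`HasGreenKubo` clause of `FourierGreenKubo`, stmt-0703, already at the level of pure analysis):
`σ = e^{-ω²/2}dω + δ_2` is finite, `C(t) = ∫cos(ωt)dσ = √(2π)e^{-t²/2} + cos 2t` has the perfect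
window `(−1, 1)` with density `e^{-ω²/2}`, `g(0) = 1`, yet `C ∉ L¹(0, ∞)` (an atom of `σ` AWAY from
`0` = an undamped oscillation of `C`, harmless for the Abel limit `π g(0)`). -/
theorem exists_window_not_integrable :
    ∃ (σ : Measure ℝ) (C : ℝ → ℝ), IsFiniteMeasure σ ∧ (∀ t : ℝ, C t = ∫ ω, Real.cos (ω * t) ∂σ) ∧
      (∃ (δ : ℝ) (g : ℝ → ℝ), 0 < δ ∧ ContinuousOn g (Ioo (-δ) δ) ∧ (∀ ω ∈ Ioo (-δ) δ, 0 ≤ g ω) ∧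
        0 < g 0 ∧ σ.restrict (Ioo (-δ) δ) =
          (volume.restrict (Ioo (-δ) δ)).withDensity fun ω => ENNReal.ofReal (g ω)) ∧
      ¬ IntegrableOn C (Ioi 0) := by
  set gauss : ℝ → ℝ := fun ω => Real.exp (-(ω ^ 2 / 2)) with hgauss
  have hgc : Continuous gauss := by
    rw [hgauss]; fun_prop
  have hgm : Measurable fun ω => ENNReal.ofReal (gauss ω) := ENNReal.measurable_ofReal.comp hgc.measurable
  set σ₁ : Measure ℝ := volume.withDensity fun ω => ENNReal.ofReal (gauss ω) with hσ₁
  haveI hfin₁ : IsFiniteMeasure σ₁ := isFiniteMeasure_withDensity_ofReal integrable_gaussian.hasFiniteIntegral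
  set C : ℝ → ℝ := fun t => Real.sqrt (2 * π) * Real.exp (-(t ^ 2 / 2)) + Real.cos (2 * t) with hCdef
  have hcosint : ∀ (ν : Measure ℝ) [IsFiniteMeasure ν] (t : ℝ), Integrable (fun ω => Real.cos (ω * t)) ν := by
    intro ν _ t
    exact (integrable_const (1 : ℝ)).mono'
      (Real.continuous_cos.comp (continuous_id.mul continuous_const)).aestronglyMeasurable
      (Eventually.of_forall fun ω => by rw [Real.norm_eq_abs]; exact Real.abs_cos_le_one _)
  refine ⟨σ₁ + Measure.dirac 2, C, inferInstance, fun t => ?_, ⟨1, gauss, one_pos, hgc.continuousOn,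
    fun ω _ => (Real.exp_pos _).le, by simp [hgauss], ?_⟩, ?_⟩
  · -- the cosine transform
    rw [integral_add_measure (hcosint σ₁ t) (hcosint _ t), integral_dirac]
    rw [hσ₁, integral_withDensity_eq_integral_toReal_smul hgm (Eventually.of_forall fun _ => ENNReal.ofReal_lt_top)]
    have : (fun ω => (ENNReal.ofReal (gauss ω)).toReal • Real.cos (ω * t)) =
        fun ω => Real.cos (ω * t) * Real.exp (-(ω ^ 2 / 2)) := by
      funext ω
      rw [ENNReal.toReal_ofReal (Real.exp_pos _).le, smul_eq_mul, mul_comm]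
    rw [this, integral_cos_mul_gaussian]
  · -- the window
    rw [Measure.restrict_add, hσ₁, restrict_withDensity measurableSet_Ioo]
    have h0 : (Measure.dirac (2 : ℝ)).restrict (Ioo (-1) 1) = 0 := by
      rw [Measure.restrict_eq_zero, Measure.dirac_apply' _ measurableSet_Ioo, indicator_of_notMem]
      norm_num
    rw [h0, add_zero]
  · -- not integrable
    intro hint
    have hA : IntegrableOn (fun t : ℝ => Real.sqrt (2 * π) * Real.exp (-(t ^ 2 / 2))) (Ioi 0) :=
      (integrable_gaussian.const_mul _).integrableOn
    have hB : IntegrableOn (fun t : ℝ => Real.cos (2 * t)) (Ioi 0) := by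
      have h := hint.sub hA
      refine h.congr_fun (fun t _ => ?_) measurableSet_Ioi
      simp only [hCdef, Pi.sub_apply]
      ring
    exact not_integrableOn_cos_two_mul hB

end WindowNotL1

end Summit.AtomisticToContinuum.FouriersLaw.Theorems.DrudeDissolution.Negative

end
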